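import Mathlib
import Literature.NumberTheory.LFunctions.Zhang2022.Section4Statements
import Literature.NumberTheory.LFunctions.Zhang2022.SkeletonAssembly
import Literature.NumberTheory.LFunctions.Zhang2022.Section4PartialIntegration
import HarnessLib

/-!
# Zhang (2022) §4, first half: DISCHARGES of typed statements of `Section4Statements`
# (theorem-only; campaign D-0069 wave 2, row owner L1-t3)

Topic `Literature/NumberTheory/LFunctions/Zhang2022` (Landau–Siegel audit tree; verdict-neutral).
Y. Zhang, *Discrete mean estimates and the Landau–Siegel zero*, arXiv:2211.02515v1 (2022)
[Zhang2022LandauSiegel] — an unrefereed manuscript under adjudication; nothing here asserts or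
denies its Theorems 1–2. This file PROVES, from the tree, some of the displayed claims of §4
pp. 16–18 that `Section4Statements` typed as `def … : Prop` (their statements are unchanged and
live there):

* `cpowBound_holds`, `cpowDerivBound_holds` — the two pointwise bounds of the proof of Lemma 4.1
  ("`|x^{s₀−s}| ≪ 𝓛`", "`|d/dx x^{s₀−s}| ≪ x⁻¹𝓛⁴⁰⁶`"; DAG `Z22:§4.u004`), from the tree's
  `Lemma41.norm_cpow_le`, `norm_deriv_cpow_le`, `norm_mul_le_rpow_406` (`Section4PartialIntegration`);
* `logDerivEqFraklDeriv_holds` — "`F′/F(s,ψ) = ∂/∂w 𝔩(s,w)|_{w=0}`" (`Z22:§4.u014`) for every branch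
  `𝔩` of `log F(s+w,ψ)/F(s,ψ)` (chain rule);
* `fraklReBound_of` — the EDGE "`𝓛⁻⁸⁸ ≪ |F(s+w,ψ)| ≪ 𝓛⁸⁸`" ⊢ "`Re 𝔩(s,w) ≪ log 𝓛`" (`u011 ⊢ u013`);
* `eq44_holds` — (4.4) unconditionally (`Skeleton.PsiChiPrimitive` is the tree theorem
  `SkeletonAssembly.psiChiPrimitive_holds`);
* `gIncreasing_holds` — "`g` is increasing" (strictly, on `x > 0`); `gInnerIntegralForm_holds`
  (`Z22:§4.u017`, "`g(x) = (2πi)⁻¹∫_{(c)} (∫₀ˣ y^{w−1}dy) ω₁(w) dw`", via Mathlib's `integral_cpow`)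
  and `gaussianLineIntegral_holds` (`Z22:§4.u018`, the Gaussian line integral, via the tree's
  `GaussWeight.integral_omega1_mul_exp`);
* `eq45_holds` — **(4.5)** "`|Z̃(s,ψ)| = (Dp²t₀²)^{1/2−σ}(1 + o(1))`" on `|Re(s−s₀)| < 100`,
  `|Im(s−s₀)| < 𝓛₁ + 3`, from the tree's Stirling estimate `GammaFactor.abs_norm_tildeZ_sub_le`
  (`Section4TildeZ`) and the bookkeeping `(t/2π)² = t₀²(1 + O(𝓛⁻¹¹⁴))²`, `|1/2 − σ| < 100`.

No new definitions, no new named facts. (4.6) is NOT discharged here: as printed it covers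
`σ ≤ 0`, where the tree's `GammaFactor.norm_logDeriv_tildeZ_add_log_le` (`0 < σ ≤ A`) does not reach.

## References

* Y. Zhang, arXiv:2211.02515v1 (2022), §4 pp. 16–18: proof of Lemma 4.1, proof of Lemma 4.3,
  (4.1), (4.4), (4.5). [cite: Zhang2022LandauSiegel, §4 pp. 16–18]
* E. C. Titchmarsh, *The Theory of the Riemann Zeta-Function*, 2nd ed. (1986), §4.12 (4.12.3)
  (Stirling for `χ(s)`, via the tree's `Section4TildeZ`). [cite: Titchmarsh1986, §4.12 (4.12.3)]
-/

noncomputable section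

open Complex Real ComplexConjugate MeasureTheory

namespace Literature.NumberTheory.LFunctions.Zhang2022.Section4

open Skeleton

/-- `𝓛 = log D > 0` for `D ≥ 2`. [cite: Zhang2022LandauSiegel, §2 (2.1)] -/
private theorem ell_pos_of_two_le' {D : ℕ} (hD : 2 ≤ D) : 0 < ell D := by
  have hD' : (1 : ℝ) < D := by exact_mod_cast hD
  exact Real.log_pos hD'

/-! ## The discharges -/

/-- `𝓛 = log D ≥ 1` for `D ≥ 3`. [cite: Zhang2022LandauSiegel, §2 (2.1)] -/
private theorem one_le_ell_of_three_le' {D : ℕ} (hD : 3 ≤ D) : 1 ≤ ell D := by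
  have hD' : (3 : ℝ) ≤ D := by exact_mod_cast hD
  have h : (1 : ℝ) < Real.log 3 := by
    rw [Real.lt_log_iff_exp_lt (by norm_num)]
    exact Real.exp_one_lt_d9.trans (by norm_num)
  exact le_trans h.le (Real.log_le_log (by norm_num) hD')

/-- `D⁸⁰ = e^{80𝓛}`. [cite: Zhang2022LandauSiegel, §4 Lemma 4.1 (proof) p. 16] -/
private theorem pow_eighty_eq_exp {D : ℕ} (hD : 3 ≤ D) : ((D : ℝ)) ^ 80 = Real.exp (80 * ell D) := by
  have hDpos : (0 : ℝ) < D := by exact_mod_cast (show 0 < D by omega)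
  rw [ell, show (80 : ℝ) * Real.log D = Real.log ((D : ℝ) ^ 80) by
    rw [Real.log_pow]; norm_num, Real.exp_log (pow_pos hDpos 80)]

/-- `Re s₀ = 1/2`, `Im s₀ = 2πt₀`. [cite: Zhang2022LandauSiegel, §2 (2.8)] -/
private theorem s0_re_im (D : ℕ) : (s0 D).re = 1 / 2 ∧ (s0 D).im = 2 * π * t0 D := by
  constructor <;> simp [Skeleton.s0, SmoothWeight.s0]

/-- **"`|x^{s₀−s}| ≪ 𝓛`" HOLDS** with the constant `1` (indeed `≤ 𝓛^{4/5}`, the tree's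
`Lemma41.norm_cpow_le`), for `D ≥ 3`. [cite: Zhang2022LandauSiegel, §4 Lemma 4.1 (proof) p. 16] -/
theorem cpowBound_holds : CpowBound := by
  refine ⟨1, ForAllLarge.of_le 3 fun D _ χ hD _ _ s hs y hy1 hyD => ?_⟩
  have hℓ1 : 1 ≤ ell D := one_le_ell_of_three_le' hD
  have hyX : y ≤ Real.exp (80 * ell D) := by rw [← pow_eighty_eq_exp hD]; exact hyD
  have hs' := (Lemma43.mem_Omega1_iff (ell D) (ell1 D) (t0 D) s).mp hs
  have hz : (s0 D - s).re ≤ Real.log (ell D) / (100 * ell D) := by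
    rw [Complex.sub_re, (s0_re_im D).1]; linarith [hs'.1]
  calc ‖(y : ℂ) ^ (s0 D - s)‖ ≤ ell D ^ (4 / 5 : ℝ) := Lemma41.norm_cpow_le hℓ1 hy1 hyX hz
    _ ≤ ell D ^ (1 : ℝ) := Real.rpow_le_rpow_of_exponent_le hℓ1 (by norm_num)
    _ = 1 * ell D := by rw [Real.rpow_one, one_mul]

/-- **"`|d/dx x^{s₀−s}| ≪ x⁻¹𝓛⁴⁰⁶`" HOLDS** with the constant `1`, for `𝓛 ≥ 32` (the tree's
`Lemma41.hasDerivAt_ofReal_cpow`, `norm_deriv_cpow_le`, `norm_mul_le_rpow_406`).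
[cite: Zhang2022LandauSiegel, §4 Lemma 4.1 (proof) p. 16] -/
theorem cpowDerivBound_holds : CpowDerivBound := by
  refine ⟨1, ForAllLarge.of_le (max 3 ⌈Real.exp 32⌉₊) fun D _ χ hD _ _ s hs y hy1 hyD => ?_⟩
  have hD3 : 3 ≤ D := le_trans (le_max_left _ _) hD
  have hDpos : (0 : ℝ) < D := by exact_mod_cast (show 0 < D by omega)
  have hL32 : 32 ≤ ell D := by
    have h : Real.exp 32 ≤ D :=
      le_trans (Nat.le_ceil _) (by exact_mod_cast le_trans (le_max_right _ _) hD)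
    rw [ell, Real.le_log_iff_exp_le hDpos]; exact h
  have hL1 : 1 ≤ ell D := by linarith
  have hL0 : 0 < ell D := by linarith
  have hy0 : 0 < y := by linarith
  have hyX : y ≤ Real.exp (80 * ell D) := by rw [← pow_eighty_eq_exp hD3]; exact hyD
  have hs' := (Lemma43.mem_Omega1_iff (ell D) (ell1 D) (t0 D) s).mp hs
  obtain ⟨hre0, him0⟩ := s0_re_im D
  set z : ℂ := s0 D - s with hz_def
  have hzre : z.re = 1 / 2 - s.re := by rw [hz_def, Complex.sub_re, hre0]
  have hzim : z.im = 2 * π * t0 D - s.im := by rw [hz_def, Complex.sub_im, him0]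
  have hlog_le : Real.log (ell D) / (100 * ell D) ≤ 1 / 2 := by
    rw [div_le_iff₀ (by positivity)]
    have := Real.log_le_sub_one_of_pos hL0
    linarith
  have hz : z.re ≤ Real.log (ell D) / (100 * ell D) := by rw [hzre]; linarith [hs'.1]
  have hre : |z.re| ≤ 1 := by
    rw [hzre, abs_le]
    constructor <;> linarith [hs'.1, hs'.2.1]
  have h405 : ell D ^ (405 : ℝ) = ell1 D := by
    rw [ell1, show (405 : ℝ) = ((405 : ℕ) : ℝ) by norm_num, Real.rpow_natCast]
  have him : |z.im| ≤ ell D ^ (405 : ℝ) + 5 := by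
    rw [h405, hzim, show 2 * π * t0 D - s.im = -(s.im - 2 * Real.pi * t0 D) by ring, abs_neg]
    exact hs'.2.2.le
  have hderiv : deriv (fun u : ℝ => (u : ℂ) ^ z) y = z * (y : ℂ) ^ (z - 1) :=
    (Lemma41.hasDerivAt_ofReal_cpow z hy0).deriv
  rw [hderiv]
  calc ‖z * (y : ℂ) ^ (z - 1)‖ ≤ ‖z‖ * ell D ^ (4 / 5 : ℝ) / y :=
        Lemma41.norm_deriv_cpow_le hL1 hy1 hyX hz
    _ ≤ ell D ^ (406 : ℝ) / y :=
        div_le_div_of_nonneg_right (Lemma41.norm_mul_le_rpow_406 hL32 hre him) hy0.le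
    _ = 1 * y⁻¹ * ell D ^ 406 := by
        rw [show (406 : ℝ) = ((406 : ℕ) : ℝ) by norm_num, Real.rpow_natCast]; ring

/-- **"`F′/F(s,ψ) = ∂/∂w 𝔩(s,w)|_{w=0}`" HOLDS** for every branch `𝔩` as in `IsFrakl` (chain rule for
`exp ∘ 𝔩` at the interior point `0`; `F(s+w)/F(s)` and `exp 𝔩(w)` agree near `0`).
[cite: Zhang2022LandauSiegel, §4 Lemma 4.3 (proof) p. 17] -/
theorem logDerivEqFraklDeriv_holds : LogDerivEqFraklDeriv := by
  intro D _ χ x s R 𝔩 hR h𝔩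
  obtain ⟨h0, hdiff, hexp⟩ := h𝔩
  have heq : (fun w => Fpoly χ x (s + w) / Fpoly χ x s) =ᶠ[nhds 0] fun w => Complex.exp (𝔩 w) := by
    filter_upwards [Metric.ball_mem_nhds (0 : ℂ) hR] with w hw
    exact (hexp w (Metric.ball_subset_closedBall hw)).symm
  have h𝔩at : DifferentiableAt ℂ 𝔩 0 :=
    hdiff.differentiableAt (Metric.closedBall_mem_nhds (0 : ℂ) hR)
  have hd : deriv (fun w => Complex.exp (𝔩 w)) 0 = Complex.exp (𝔩 0) * deriv 𝔩 0 :=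
    h𝔩at.hasDerivAt.cexp.deriv
  calc deriv (Fpoly χ x) s / Fpoly χ x s
      = deriv (fun w => Fpoly χ x (s + w)) 0 / Fpoly χ x s := by
        rw [deriv_comp_const_add]; simp
    _ = deriv (fun w => Fpoly χ x (s + w) / Fpoly χ x s) 0 := by rw [deriv_div_const]
    _ = deriv (fun w => Complex.exp (𝔩 w)) 0 := heq.deriv_eq
    _ = deriv 𝔩 0 := by rw [hd, h0, Complex.exp_zero, one_mul]

/-- **(4.4) HOLDS** (unconditionally: `Skeleton.PsiChiPrimitive` is the tree theorem
`SkeletonAssembly.psiChiPrimitive_holds`). [cite: Zhang2022LandauSiegel, §4 (4.4) p. 18] -/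
theorem eq44_holds : Eq44 := eq44_of_psiChiPrimitive psiChiPrimitive_holds

/-- **"`g` is increasing" HOLDS** (strictly, on `x > 0`): the Gaussian integrand is positive.
[cite: Zhang2022LandauSiegel, §4 (4.1) p. 18] -/
theorem gIncreasing_holds : GIncreasing := by
  refine ForAllLarge.of_le 2 fun D _ χ hD _ _ => ?_
  have hΛ : 0 < ell D ^ 30 := pow_pos (ell_pos_of_two_le' hD) 30
  intro a ha b hb hab
  simp only [Set.mem_Ioi] at ha hb
  show GaussWeight.gWeight (ell D ^ 30) a < GaussWeight.gWeight (ell D ^ 30) b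
  unfold GaussWeight.gWeight
  have hint := GaussWeight.integrable_gauss hΛ
  have hsub : (∫ u in Set.Iic (Real.log b), GaussWeight.gauss (ell D ^ 30) u)
      - ∫ u in Set.Iic (Real.log a), GaussWeight.gauss (ell D ^ 30) u
      = ∫ u in Real.log a..Real.log b, GaussWeight.gauss (ell D ^ 30) u :=
    intervalIntegral.integral_Iic_sub_Iic hint.integrableOn hint.integrableOn
  have hpos : 0 < ∫ u in Real.log a..Real.log b, GaussWeight.gauss (ell D ^ 30) u :=
    intervalIntegral.intervalIntegral_pos_of_pos_on hint.intervalIntegrable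
      (fun u _ => GaussWeight.gauss_pos _ u) (Real.log_lt_log ha hab)
  have hc : 0 < Real.sqrt (ell D ^ 30 / π) := Real.sqrt_pos.mpr (by positivity)
  exact mul_lt_mul_of_pos_left (by linarith) hc

/-- `(200𝓛)⁻¹log 𝓛 ≥ 0` once `𝓛 ≥ 1`. [cite: Zhang2022LandauSiegel, §4 Lemma 4.3 (proof) p. 17] -/
private theorem rad43_nonneg {D : ℕ} (h : 1 ≤ ell D) : 0 ≤ rad43 D :=
  div_nonneg (Real.log_nonneg h) (by linarith)

/-- **Edge: "`𝓛⁻⁸⁸ ≪ |F(s+w,ψ)| ≪ 𝓛⁸⁸`" ⊢ "`Re 𝔩(s,w) ≪ log 𝓛`"** (for any branch `𝔩`: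
`Re 𝔩(s,w) = log|F(s+w,ψ)/F(s,ψ)| ≤ 2 log C + 176 log 𝓛`). Kernel-checked.
[cite: Zhang2022LandauSiegel, §4 Lemma 4.3 (proof) p. 17] -/
theorem fraklReBound_of (h : FTwoSided88) : FraklReBound := by
  obtain ⟨C, hC⟩ := h
  refine ⟨2 * Real.log (max C 1) + 176, ?_⟩
  have hlarge : ForAllLarge fun D _ _ => 1 ≤ Real.log (ell D) ∧ 0 < ell D :=
    ForAllLarge.of_le ⌈Real.exp (Real.exp 1)⌉₊ fun D _ χ hD _ _ => by
      have h1 : Real.exp (Real.exp 1) ≤ D := le_trans (Nat.le_ceil _) (by exact_mod_cast hD)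
      have hDpos : (0 : ℝ) < D := lt_of_lt_of_le (Real.exp_pos _) h1
      have h2 : Real.exp 1 ≤ ell D := by rw [ell, Real.le_log_iff_exp_le hDpos]; exact h1
      have hℓ : 0 < ell D := lt_of_lt_of_le (Real.exp_pos _) h2
      exact ⟨by rw [Real.le_log_iff_exp_le hℓ]; exact h2, hℓ⟩
  refine (hC.and hlarge).mono ?_
  intro D _ χ _ _ hh x hx s hs 𝔩 h𝔩 w hw
  obtain ⟨hC', hlog1, hℓ⟩ := hh
  obtain ⟨-, -, hexp⟩ := h𝔩
  have hℓ1 : 1 ≤ ell D := by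
    have := Real.add_one_le_exp 1
    have h2 : Real.exp 1 ≤ ell D := by rwa [Real.le_log_iff_exp_le hℓ] at hlog1
    linarith
  have hw' : ‖w‖ ≤ rad43 D := by simpa [Metric.mem_closedBall, dist_zero_right] using hw
  have hup : ‖Fpoly χ x (s + w)‖ ≤ C * ell D ^ 88 := (hC' x hx s hs w hw').2
  have hlo : (ell D ^ 88)⁻¹ ≤ C * ‖Fpoly χ x s‖ := by
    have h0 : ‖(0 : ℂ)‖ ≤ rad43 D := by rw [norm_zero]; exact rad43_nonneg hℓ1
    simpa using (hC' x hx s hs 0 h0).1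
  have hLpow : 0 < ell D ^ 88 := pow_pos hℓ 88
  have hinv : 0 < (ell D ^ 88)⁻¹ := inv_pos.mpr hLpow
  have hCpos : 0 < C := by
    by_contra hle
    push Not at hle
    have : C * ‖Fpoly χ x s‖ ≤ 0 := mul_nonpos_of_nonpos_of_nonneg hle (norm_nonneg _)
    linarith
  have hFs : 0 < ‖Fpoly χ x s‖ := by
    by_contra hle
    push Not at hle
    have h0 : ‖Fpoly χ x s‖ = 0 := le_antisymm hle (norm_nonneg _)
    rw [h0, mul_zero] at hlo
    linarith
  have hq : ‖Fpoly χ x (s + w) / Fpoly χ x s‖ ≤ C ^ 2 * ell D ^ 176 := by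
    rw [norm_div, div_le_iff₀ hFs]
    have h1 : (ell D ^ 88)⁻¹ / C ≤ ‖Fpoly χ x s‖ := by rw [div_le_iff₀' hCpos]; exact hlo
    calc ‖Fpoly χ x (s + w)‖ ≤ C * ell D ^ 88 := hup
      _ = C ^ 2 * ell D ^ 176 * ((ell D ^ 88)⁻¹ / C) := by field_simp
      _ ≤ C ^ 2 * ell D ^ 176 * ‖Fpoly χ x s‖ := by gcongr
  have hnorm : Real.exp ((𝔩 w).re) = ‖Fpoly χ x (s + w) / Fpoly χ x s‖ := by
    rw [← Complex.norm_exp, hexp w hw]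
  have hqpos : 0 < ‖Fpoly χ x (s + w) / Fpoly χ x s‖ := by rw [← hnorm]; exact Real.exp_pos _
  have hre : (𝔩 w).re = Real.log ‖Fpoly χ x (s + w) / Fpoly χ x s‖ := by
    rw [← hnorm, Real.log_exp]
  rw [hre]
  have hm : 0 ≤ Real.log (max C 1) := Real.log_nonneg (le_max_right _ _)
  calc Real.log ‖Fpoly χ x (s + w) / Fpoly χ x s‖
      ≤ Real.log (C ^ 2 * ell D ^ 176) := Real.log_le_log hqpos hq
    _ = 2 * Real.log C + 176 * Real.log (ell D) := by
        rw [Real.log_mul (by positivity) (by positivity), Real.log_pow, Real.log_pow]; push_cast; ring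
    _ ≤ 2 * Real.log (max C 1) + 176 * Real.log (ell D) := by
        gcongr
        · exact le_max_left _ _
    _ ≤ (2 * Real.log (max C 1) + 176) * Real.log (ell D) := by nlinarith

/-- `|log r| ≤ 2|r − 1|` for `|r − 1| ≤ 1/2` (the manuscript's "`(1 + o(1))`" bookkeeping).
[cite: Zhang2022LandauSiegel, §4 (4.5) p. 18] -/
private theorem abs_log_le_two_mul_abs {r : ℝ} (h : |r - 1| ≤ 1 / 2) :
    |Real.log r| ≤ 2 * |r - 1| := by
  have hr : 1 / 2 ≤ r := by linarith [(abs_le.mp h).1]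
  have hr2 : r ≤ 3 / 2 := by linarith [(abs_le.mp h).2]
  have hr0 : 0 < r := by linarith
  have habs : 0 ≤ |r - 1| := abs_nonneg _
  rw [abs_le]
  constructor
  · have h1 : 1 - r⁻¹ ≤ Real.log r := Real.one_sub_inv_le_log_of_pos hr0
    have h2 : -(2 * |r - 1|) ≤ 1 - r⁻¹ := by
      have h3 : 1 - r⁻¹ = (r - 1) / r := by field_simp
      rw [h3, le_div_iff₀ hr0]
      have h4 := neg_abs_le (r - 1)
      nlinarith
    linarith
  · have := Real.log_le_sub_one_of_pos hr0
    linarith [le_abs_self (r - 1)]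

set_option maxHeartbeats 400000 in
/-- **(4.5) HOLDS**: "`|Z̃(s,ψ)| = (Dp²t₀²)^{1/2−σ}(1 + o(1))`" on `|Re(s − s₀)| < 100`,
`|Im(s − s₀)| < 𝓛₁ + 3` — for every `ε > 0`, `| |Z̃(s,ψ)| − M | ≤ εM` with `M = (Dp²t₀²)^{1/2−σ}`
once `𝓛 ≥ max(395352, 23721120/ε)`. From the tree's Stirling estimate `GammaFactor.abs_norm_tildeZ_sub_le`
(`| |Z̃(σ+it)| − M₁ | ≤ (570·102²/t)M₁`, `M₁ = (p·Dp·(t/2π)²)^{1/2−σ}`, `|σ| ≤ 101`, `t ≥ 38·102²`) and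
the bookkeeping `M₁ = M·(t/2πt₀)^{2(1/2−σ)}`, `|t/2πt₀ − 1| ≤ 𝓛⁻¹¹⁴`, `|1/2 − σ| < 100`
(`ψχ` primitive: `SkeletonAssembly.psiChiPrimitive_holds`). [cite: Zhang2022LandauSiegel, §4 (4.5) p. 18] -/
theorem eq45_holds : Eq45 := by
  intro ε hε
  refine ForAllLarge.of_le (max 3 ⌈Real.exp (max 395352 (23721120 / ε))⌉₊)
    fun D _ χ hD _ hχ x s hs => ?_
  have hD3 : 3 ≤ D := le_trans (le_max_left _ _) hD
  have hDpos : (0 : ℝ) < D := by exact_mod_cast (show 0 < D by omega)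
  have hL : max 395352 (23721120 / ε) ≤ ell D := by
    have h : Real.exp (max 395352 (23721120 / ε)) ≤ D :=
      le_trans (Nat.le_ceil _) (by exact_mod_cast le_trans (le_max_right _ _) hD)
    rw [ell, Real.le_log_iff_exp_le hDpos]; exact h
  have hLbig : 395352 ≤ ell D := le_trans (le_max_left _ _) hL
  have hLε : 23721120 / ε ≤ ell D := le_trans (le_max_right _ _) hL
  have hLε' : 23721120 ≤ ε * ell D := by rwa [div_le_iff₀' hε] at hLε
  have hL1 : 1 ≤ ell D := by linarith
  have hL0 : 0 < ell D := by linarith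
  -- the region
  obtain ⟨hs0re, hs0im⟩ := s0_re_im D
  have hs' : |(s - s0 D).re| < 100 ∧ |(s - s0 D).im| < ell1 D + 3 := hs
  obtain ⟨hre, him⟩ := hs'
  rw [Complex.sub_re, hs0re] at hre
  rw [Complex.sub_im, hs0im] at him
  have ht0 : t0 D = ell D ^ 519 := rfl
  have hell1 : ell1 D = ell D ^ 405 := rfl
  have ht0pos : 0 < t0 D := by rw [ht0]; exact pow_pos hL0 519
  have h405 : ell D ^ 405 ≤ ell D ^ 519 := pow_le_pow_right₀ hL1 (by norm_num)
  have h114 : ell D ^ 114 ≤ ell D ^ 519 := pow_le_pow_right₀ hL1 (by norm_num)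
  have h405one : (1 : ℝ) ≤ ell D ^ 405 := one_le_pow₀ hL1
  have h519one : (1 : ℝ) ≤ ell D ^ 519 := one_le_pow₀ hL1
  have hL114 : ell D ≤ ell D ^ 114 := by
    calc ell D = ell D ^ 1 := (pow_one _).symm
      _ ≤ ell D ^ 114 := pow_le_pow_right₀ hL1 (by norm_num)
  have h114big : 395352 ≤ ell D ^ 114 := le_trans hLbig hL114
  -- t ≥ 𝓛⁵¹⁹
  have hπ519 : 3 * ell D ^ 519 ≤ π * ell D ^ 519 :=
    mul_le_mul_of_nonneg_right Real.pi_gt_three.le (by linarith)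
  have hπ405 : 3 * ell D ^ 405 ≤ π * ell D ^ 405 :=
    mul_le_mul_of_nonneg_right Real.pi_gt_three.le (by linarith)
  have htlow : ell D ^ 519 ≤ s.im := by
    have h1 := (abs_lt.mp him).1
    rw [hell1, ht0] at h1
    linarith
  have htpos : 0 < s.im := by linarith
  -- |σ| ≤ 101 and the height condition of the tree lemma
  have hσA : |s.re| ≤ 101 := by
    have := abs_lt.mp hre
    rw [abs_le]; constructor <;> linarith
  have ht38 : 38 * ((101 : ℝ) + 1) ^ 2 ≤ s.im := by
    rw [show 38 * ((101 : ℝ) + 1) ^ 2 = 395352 by norm_num]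
    linarith
  -- the tree's Stirling estimate
  have hθ : (psiChi χ x).IsPrimitive := psiChiPrimitive_holds D χ x hD3 hχ
  have key := GammaFactor.abs_norm_tildeZ_sub_le (ψ := x.ψ) (θ₂ := psiChi χ x) x.prim hθ
    (A := 101) (σ := s.re) (t := s.im) (by norm_num) hσA ht38
  rw [Complex.re_add_im s] at key
  have hZeq : GammaFactor.tildeZ x.ψ (psiChi χ x) s = tildeZW χ x s := rfl
  rw [hZeq] at key
  -- bookkeeping: M₁ = M · exp u, with r = t/(2πt₀), u = (1/2 − σ)·log r²
  obtain ⟨r, hr⟩ : ∃ r : ℝ, r = s.im / (2 * π * t0 D) := ⟨_, rfl⟩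
  obtain ⟨M, hM⟩ : ∃ M : ℝ, M = ((D : ℝ) * (x.p : ℝ) ^ 2 * t0 D ^ 2) ^ (1 / 2 - s.re) := ⟨_, rfl⟩
  obtain ⟨u, hu⟩ : ∃ u : ℝ, u = Real.log (r ^ 2) * (1 / 2 - s.re) := ⟨_, rfl⟩
  have hppos : (0 : ℝ) < x.p := by exact_mod_cast x.prime.pos
  have hπ : (π : ℝ) ≠ 0 := Real.pi_ne_zero
  have ht0ne : t0 D ≠ 0 := ht0pos.ne'
  have hden : 0 < 2 * π * t0 D := mul_pos (mul_pos two_pos Real.pi_pos) ht0pos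
  have hrpos : 0 < r := by rw [hr]; exact div_pos htpos hden
  have hbase_pos : (0 : ℝ) < (D : ℝ) * (x.p : ℝ) ^ 2 * t0 D ^ 2 :=
    mul_pos (mul_pos hDpos (pow_pos hppos 2)) (pow_pos ht0pos 2)
  have hMpos : 0 < M := by rw [hM]; exact Real.rpow_pos_of_pos hbase_pos _
  have hM1 : ((x.p : ℝ) * ((D * x.p : ℕ) : ℝ) * (s.im / (2 * π)) ^ 2) ^ (1 / 2 - s.re)
      = M * Real.exp u := by
    have hsplit : (x.p : ℝ) * ((D * x.p : ℕ) : ℝ) * (s.im / (2 * π)) ^ 2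
        = ((D : ℝ) * (x.p : ℝ) ^ 2 * t0 D ^ 2) * r ^ 2 := by
      rw [hr]; push_cast; field_simp
    rw [hsplit, Real.mul_rpow hbase_pos.le (sq_nonneg r), hM, hu,
      Real.rpow_def_of_pos (pow_pos hrpos 2)]
  rw [hM1] at key
  rw [← hM]
  -- |r − 1| ≤ 𝓛⁻¹¹⁴
  have h114pos : 0 < ell D ^ 114 := pow_pos hL0 114
  have h114ne : ell D ^ 114 ≠ 0 := h114pos.ne'
  have hr1 : |r - 1| ≤ (ell D ^ 114)⁻¹ := by
    have hr_sub : r - 1 = (s.im - 2 * π * t0 D) / (2 * π * t0 D) := by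
      rw [hr]; field_simp
    rw [hr_sub, abs_div, abs_of_pos hden, div_le_iff₀ hden, ht0]
    have h1 : |s.im - 2 * π * ell D ^ 519| ≤ ell D ^ 405 + 3 := by
      rw [← ht0, ← hell1]; exact him.le
    have hsplit : ell D ^ 519 = ell D ^ 405 * ell D ^ 114 := by rw [← pow_add]
    have h2 : (ell D ^ 114)⁻¹ * (2 * π * ell D ^ 519) = 2 * π * ell D ^ 405 := by
      rw [hsplit]; field_simp
    rw [h2]
    linarith
  have hinv_small : (ell D ^ 114)⁻¹ ≤ 1 / 395352 := by
    rw [one_div, inv_le_inv₀ h114pos (by norm_num)]; exact h114big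
  have hr_half : |r - 1| ≤ 1 / 2 := by linarith
  -- |u| ≤ 400 |r − 1| ≤ 400 𝓛⁻¹¹⁴
  have hlogr : |Real.log r| ≤ 2 * |r - 1| := abs_log_le_two_mul_abs hr_half
  have he100 : |1 / 2 - s.re| ≤ 100 := by rw [abs_sub_comm]; exact hre.le
  have hu_le : |u| ≤ 400 * (ell D ^ 114)⁻¹ := by
    rw [hu, Real.log_pow, abs_mul]
    push_cast
    rw [abs_mul, abs_two]
    calc 2 * |Real.log r| * |1 / 2 - s.re| ≤ 2 * (2 * |r - 1|) * 100 := by gcongr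
      _ = 400 * |r - 1| := by ring
      _ ≤ 400 * (ell D ^ 114)⁻¹ := by gcongr
  have hu1 : |u| ≤ 1 := by linarith
  have hexp1 : |Real.exp u - 1| ≤ 2 * |u| := Real.abs_exp_sub_one_le hu1
  have hE1 : |Real.exp u - 1| ≤ 1 := by linarith
  have hEε : |Real.exp u - 1| ≤ ε / 4 := by
    have h1 : (ell D ^ 114)⁻¹ ≤ (ell D)⁻¹ := inv_anti₀ hL0 hL114
    have h2 : (ell D)⁻¹ ≤ ε / 23721120 := by
      rw [inv_le_comm₀ hL0 (by positivity), inv_div]; exact hLε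
    calc |Real.exp u - 1| ≤ 2 * |u| := hexp1
      _ ≤ 800 * (ell D ^ 114)⁻¹ := by linarith
      _ ≤ 800 * (ε / 23721120) := by gcongr; exact h1.trans h2
      _ ≤ ε / 4 := by linarith
  -- the tree's relative error ≤ ε/4
  have hδ : 570 * ((101 : ℝ) + 1) ^ 2 / s.im ≤ ε / 4 := by
    rw [show 570 * ((101 : ℝ) + 1) ^ 2 = 5930280 by norm_num]
    have h1 : ell D ≤ s.im := le_trans (le_trans hL114 h114) htlow
    calc (5930280 : ℝ) / s.im ≤ 5930280 / ell D :=
          div_le_div_of_nonneg_left (by norm_num) hL0 h1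
      _ ≤ ε / 4 := by rw [div_le_iff₀ hL0]; linarith
  -- assembly
  have hexp_le : Real.exp u ≤ 2 := by linarith [(abs_le.mp hE1).2]
  have hδ0 : 0 ≤ 570 * ((101 : ℝ) + 1) ^ 2 / s.im := by positivity
  have hZM1 : 0 ≤ M * Real.exp u := (mul_pos hMpos (Real.exp_pos u)).le
  have hMexp : M * Real.exp u ≤ M * 2 := mul_le_mul_of_nonneg_left hexp_le hMpos.le
  have hsecond : |M * Real.exp u - M| = M * |Real.exp u - 1| := by
    rw [← mul_sub_one, abs_mul, abs_of_pos hMpos]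
  calc |‖tildeZW χ x s‖ - M|
      ≤ |‖tildeZW χ x s‖ - M * Real.exp u| + |M * Real.exp u - M| := abs_sub_le _ _ _
    _ ≤ 570 * ((101 : ℝ) + 1) ^ 2 / s.im * (M * Real.exp u) + M * |Real.exp u - 1| :=
        add_le_add key hsecond.le
    _ ≤ ε / 4 * (M * 2) + M * (ε / 4) :=
        add_le_add (mul_le_mul hδ hMexp hZM1 (by positivity))
          (mul_le_mul_of_nonneg_left hEε hMpos.le)
    _ ≤ ε * M := by nlinarith

/-- **"`g(x) = (2πi)⁻¹∫_{(c)} (∫₀ˣ y^{w−1}dy) ω₁(w) dw`" HOLDS** (DAG `Z22:§4.u017`): the inner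
integral is `x^w/w` (`Re w = c > 0`, Mathlib's `integral_cpow`), and then this is the manuscript's
definition of `g` (`gContourDef_holds`). [cite: Zhang2022LandauSiegel, §4 p. 18] -/
theorem gInnerIntegralForm_holds : GInnerIntegralForm := by
  refine ForAllLarge.of_le 2 fun D _ χ hD _ _ c hc y hy => ?_
  have hΛ : 0 < ell D ^ 30 := pow_pos (ell_pos_of_two_le' hD) 30
  have hinner : ∀ v : ℝ, ∫ u in (0 : ℝ)..y, (u : ℂ) ^ ((c : ℂ) + v * I - 1)
      = (y : ℂ) ^ ((c : ℂ) + v * I) / ((c : ℂ) + v * I) := by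
    intro v
    have hw : (c : ℂ) + v * I ≠ 0 := GaussWeight.line_ne_zero hc.ne' v
    have hr : -1 < ((c : ℂ) + v * I - 1).re := by simp; linarith
    rw [integral_cpow (Or.inl hr), sub_add_cancel, Complex.ofReal_zero, Complex.zero_cpow hw,
      sub_zero]
  have hfun : (fun v : ℝ => (∫ u in (0 : ℝ)..y, (u : ℂ) ^ ((c : ℂ) + v * I - 1)) *
        omega1W D (c + v * I))
      = fun v : ℝ => (y : ℂ) ^ ((c : ℂ) + v * I) * omega1W D (c + v * I) / (c + v * I) := by
    funext v
    rw [hinner v, div_mul_eq_mul_div]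
  rw [hfun]
  simpa only [omega1W, gW] using GaussWeight.gWeight_eq_verticalIntegral hΛ hc hy

/-- **The Gaussian line integral HOLDS** (DAG `Z22:§4.u018`): "`(2πi)⁻¹∫_{(c)} exp{(log y)w +
w²/(4𝓛³⁰)} dw = (𝓛¹⁵/√π)exp{−𝓛³⁰(log y)²}`" (the tree's `GaussWeight.integral_omega1_mul_exp`,
`√(4π𝓛³⁰) = 2√π𝓛¹⁵`). [cite: Zhang2022LandauSiegel, §4 p. 18] -/
theorem gaussianLineIntegral_holds : GaussianLineIntegral := by
  refine ForAllLarge.of_le 2 fun D _ χ hD _ _ c hc y hy => ?_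
  have hℓ : 0 < ell D := ell_pos_of_two_le' hD
  have hΛ : 0 < ell D ^ 30 := pow_pos hℓ 30
  have hfun : (fun v : ℝ => Complex.exp ((Real.log y : ℂ) * ((c : ℂ) + v * I)
        + ((c : ℂ) + v * I) ^ 2 / (4 * (ell D : ℂ) ^ 30)))
      = fun v : ℝ => GaussWeight.omega1 (ell D ^ 30) (c + v * I)
          * Complex.exp ((c + v * I) * (Real.log y)) := by
    funext v
    rw [GaussWeight.omega1, ← Complex.exp_add]
    congr 1
    push_cast
    ring
  rw [hfun, GaussWeight.integral_omega1_mul_exp hΛ c (Real.log y), GaussWeight.gauss]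
  have hsq : Real.sqrt (4 * π * ell D ^ 30) = 2 * Real.sqrt π * ell D ^ 15 := by
    rw [show 4 * π * ell D ^ 30 = π * (2 * ell D ^ 15) ^ 2 by ring,
      Real.sqrt_mul Real.pi_pos.le, Real.sqrt_sq (by positivity)]
    ring
  rw [hsq, show (1 / (2 * π) : ℂ) = ((1 / (2 * π) : ℝ) : ℂ) by push_cast; ring,
    ← Complex.ofReal_mul]
  congr 1
  set q : ℝ := Real.sqrt π with hqdef
  have hqpos : 0 < q := Real.sqrt_pos.mpr Real.pi_pos
  have hq : q ^ 2 = π := Real.sq_sqrt Real.pi_pos.le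
  rw [← hq]
  field_simp

end Literature.NumberTheory.LFunctions.Zhang2022.Section4
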